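import Literature.NumberTheory.Transcendental.KZCalculusProofs
import Literature.NumberTheory.Transcendental.KZCubeProducts
import Literature.Analysis.SpecialFunctions.SelbergIntegralBasic
import Mathlib.MeasureTheory.Integral.Pi
import Mathlib.MeasureTheory.Constructions.Pi

/-!
# Absolute integrability of the Legendre divergence pieces (engine client L4)

Line cusp-transport / hodge-locus of the crux `CompleteModGammaSector`
(stmt-KontsevichZagierPeriods-14233), shared transport engine E2', first client: propagation of
the modulus in Legendre's family. The modulus-derivative of Legendre's combination is a
divergence `∂ₘF = ∂ₓG₁ + ∂_yG₂`; the engine needs the two pieces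

* `g₁ (x, y, m) = ½ y² (1-x²)^{-1/2} (1-mx²)^{-1/2} (1-y²)^{-1/2} (1-(1-m)y²)^{-1/2}
    · ((1 - 2x²) + m x² (1-x²)/(1-mx²))`,
* `g₂ (x, y, m) = -½ x² (1-x²)^{-1/2} (1-mx²)^{-1/2} (1-y²)^{-1/2} (1-(1-m)y²)^{-1/2}
    · ((1 - 2y²) + (1-m) y² (1-y²)/(1-(1-m)y²))`

to be absolutely integrable on the open band `(0,1) × (0,1) × (m₀, m₁)`, `0 < m₀ < m₁ < 1`.

Proof: on the band `|gᵢ| ≤ K(m₀, m₁) · (1-x)^{-1/2} (1-y)^{-1/2}` with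
`K = ½ (1-m₁)^{-1/2} m₀^{-1/2} (1 + 1/(1-m₁) + 1/m₀)` (using `1 - m x² ≥ 1 - m₁`,
`1 - (1-m) y² ≥ m₀`, `1 - x² ≥ 1 - x`); the majorant is a product of one-variable integrable
functions (`(1-u)^{-1/2} ∈ L¹(0,1)`, the arcsine/Beta integrand `B(1, ½)`), hence integrable for
the product measure (Tonelli, `MeasureTheory.Integrable.fintype_prod`), and the `gᵢ` are
continuous on the open band, so `MeasureTheory.Integrable.mono'` applies.

## References

* M. Kontsevich, D. Zagier, *Periods*, in: Mathematics Unlimited — 2001 and Beyond, Springer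
  (2001), §1.2 (the Legendre family example) and §4.1.
-/

noncomputable section
set_option linter.dupNamespace false

namespace Summit.KontsevichZagierPeriods.KontsevichZagierPeriods.CompleteModGammaSectorEngine

open MeasureTheory Set
open Literature.NumberTheory.Transcendental
open Literature.NumberTheory.Transcendental.KZ

/-- `1/√(1-x²) ≤ (1-x)^{-1/2}` for `x ∈ (0,1)` (since `1 - x ≤ 1 - x²`). [folklore] -/
private theorem one_div_sqrt_le_rpow {x : ℝ} (hx : x ∈ Ioo (0:ℝ) 1) :
    1 / Real.sqrt (1 - x ^ 2) ≤ (1 - x) ^ (-(1/2:ℝ)) := by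
  have h1 : 0 < 1 - x := by linarith [hx.2]
  have hle : 1 - x ≤ 1 - x ^ 2 := by nlinarith [hx.1, hx.2]
  rw [Real.rpow_neg h1.le, ← Real.sqrt_eq_rpow, ← one_div]
  exact one_div_le_one_div_of_le (Real.sqrt_pos.2 h1) (Real.sqrt_le_sqrt hle)

/-- The common domination step: for `x, y ∈ (0,1)`, `m ∈ (m₀, m₁)`, a weight `w ∈ [0,1]` and a
bracket `b` with `|b| ≤ 1 + 1/(1-m₁) + 1/m₀`,
`|½ w (√(1-x²)√(1-mx²))⁻¹ (√(1-y²)√(1-(1-m)y²))⁻¹ b| ≤ K (1-x)^{-1/2} (1-y)^{-1/2}`. [folklore] -/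
private theorem core_bound {m₀ m₁ x y m w b : ℝ} (hm₀ : 0 < m₀) (hm₁ : m₁ < 1)
    (hx : x ∈ Ioo (0:ℝ) 1) (hy : y ∈ Ioo (0:ℝ) 1) (hm : m ∈ Ioo m₀ m₁)
    (hw : 0 ≤ w) (hw1 : w ≤ 1) (hb : |b| ≤ 1 + 1 / (1 - m₁) + 1 / m₀) :
    |1 / 2 * w * (1 / (Real.sqrt (1 - x ^ 2) * Real.sqrt (1 - m * x ^ 2))) *
        (1 / (Real.sqrt (1 - y ^ 2) * Real.sqrt (1 - (1 - m) * y ^ 2))) * b| ≤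
      1 / 2 * (1 / Real.sqrt (1 - m₁)) * (1 / Real.sqrt m₀) * (1 + 1 / (1 - m₁) + 1 / m₀) *
        ((1 - x) ^ (-(1/2:ℝ)) * (1 - y) ^ (-(1/2:ℝ))) := by
  obtain ⟨hx0, hx1⟩ := hx
  obtain ⟨hy0, hy1⟩ := hy
  obtain ⟨hmm0, hmm1⟩ := hm
  have hA : 0 < 1 - x ^ 2 := by nlinarith
  have hB0 : 0 < 1 - m₁ := by linarith
  have hB : 1 - m₁ ≤ 1 - m * x ^ 2 := by nlinarith
  have hC : 0 < 1 - y ^ 2 := by nlinarith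
  have hD : m₀ ≤ 1 - (1 - m) * y ^ 2 := by nlinarith
  have hsA : 0 < Real.sqrt (1 - x ^ 2) := Real.sqrt_pos.2 hA
  have hsB : 0 < Real.sqrt (1 - m * x ^ 2) := Real.sqrt_pos.2 (hB0.trans_le hB)
  have hsC : 0 < Real.sqrt (1 - y ^ 2) := Real.sqrt_pos.2 hC
  have hsD : 0 < Real.sqrt (1 - (1 - m) * y ^ 2) := Real.sqrt_pos.2 (hm₀.trans_le hD)
  have h1 : 1 / Real.sqrt (1 - x ^ 2) ≤ (1 - x) ^ (-(1/2:ℝ)) := one_div_sqrt_le_rpow ⟨hx0, hx1⟩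
  have h2 : 1 / Real.sqrt (1 - m * x ^ 2) ≤ 1 / Real.sqrt (1 - m₁) :=
    one_div_le_one_div_of_le (Real.sqrt_pos.2 hB0) (Real.sqrt_le_sqrt hB)
  have h3 : 1 / Real.sqrt (1 - y ^ 2) ≤ (1 - y) ^ (-(1/2:ℝ)) := one_div_sqrt_le_rpow ⟨hy0, hy1⟩
  have h4 : 1 / Real.sqrt (1 - (1 - m) * y ^ 2) ≤ 1 / Real.sqrt m₀ :=
    one_div_le_one_div_of_le (Real.sqrt_pos.2 hm₀) (Real.sqrt_le_sqrt hD)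
  have hx' : 0 < 1 - x := by linarith
  have hy' : 0 < 1 - y := by linarith
  have hfx : 0 ≤ (1 - x) ^ (-(1/2:ℝ)) := Real.rpow_nonneg hx'.le _
  have hfy : 0 ≤ (1 - y) ^ (-(1/2:ℝ)) := Real.rpow_nonneg hy'.le _
  have hK1 : 0 < 1 / Real.sqrt (1 - m₁) := by positivity
  have hK2 : 0 < 1 / Real.sqrt m₀ := by positivity
  simp only [abs_mul, abs_div, abs_one, abs_two, abs_of_pos hsA, abs_of_pos hsB, abs_of_pos hsC,
    abs_of_pos hsD, abs_of_nonneg hw]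
  calc 1 / 2 * w * (1 / (Real.sqrt (1 - x ^ 2) * Real.sqrt (1 - m * x ^ 2))) *
        (1 / (Real.sqrt (1 - y ^ 2) * Real.sqrt (1 - (1 - m) * y ^ 2))) * |b|
      = 1 / 2 * w * (1 / Real.sqrt (1 - x ^ 2) * (1 / Real.sqrt (1 - m * x ^ 2))) *
        (1 / Real.sqrt (1 - y ^ 2) * (1 / Real.sqrt (1 - (1 - m) * y ^ 2))) * |b| := by
        rw [one_div_mul_one_div, one_div_mul_one_div]
    _ ≤ 1 / 2 * 1 * ((1 - x) ^ (-(1/2:ℝ)) * (1 / Real.sqrt (1 - m₁))) *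
        ((1 - y) ^ (-(1/2:ℝ)) * (1 / Real.sqrt m₀)) * (1 + 1 / (1 - m₁) + 1 / m₀) := by
        gcongr
    _ = _ := by ring

/-- Bound on the first bracket: `|(1 - 2x²) + m x²(1-x²)/(1-mx²)| ≤ 1 + 1/(1-m₁) + 1/m₀` for
`x ∈ (0,1)`, `m ∈ (m₀, m₁) ⊆ (0,1)`. [folklore] -/
private theorem bracket_bound_one {m₀ m₁ x m : ℝ} (hm₀ : 0 < m₀) (hm₁ : m₁ < 1)
    (hx : x ∈ Ioo (0:ℝ) 1) (hm : m ∈ Ioo m₀ m₁) :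
    |(1 - 2 * x ^ 2) + m * x ^ 2 * (1 - x ^ 2) / (1 - m * x ^ 2)| ≤
      1 + 1 / (1 - m₁) + 1 / m₀ := by
  obtain ⟨hx0, hx1⟩ := hx
  obtain ⟨hmm0, hmm1⟩ := hm
  have hm0 : 0 < m := hm₀.trans hmm0
  have hx2 : x ^ 2 ≤ 1 := by nlinarith
  have hB0 : 0 < 1 - m₁ := by linarith
  have hB : 1 - m₁ ≤ 1 - m * x ^ 2 := by nlinarith
  have hBpos : 0 < 1 - m * x ^ 2 := hB0.trans_le hB
  have hnum0 : 0 ≤ m * x ^ 2 * (1 - x ^ 2) := by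
    have : 0 ≤ 1 - x ^ 2 := by linarith
    positivity
  have hnum1 : m * x ^ 2 * (1 - x ^ 2) ≤ 1 := by
    have h' : m * x ^ 2 ≤ 1 := by nlinarith
    have h'' : 0 ≤ m * x ^ 2 := by positivity
    nlinarith
  have hq0 : 0 ≤ m * x ^ 2 * (1 - x ^ 2) / (1 - m * x ^ 2) := div_nonneg hnum0 hBpos.le
  have hq1 : m * x ^ 2 * (1 - x ^ 2) / (1 - m * x ^ 2) ≤ 1 / (1 - m₁) :=
    div_le_div₀ zero_le_one hnum1 hB0 hB
  have hm0' : 0 < 1 / m₀ := by positivity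
  rw [abs_le]
  constructor <;> nlinarith [sq_nonneg x]

/-- Bound on the second bracket: `|(1 - 2y²) + (1-m) y²(1-y²)/(1-(1-m)y²)| ≤ 1 + 1/(1-m₁) + 1/m₀`
for `y ∈ (0,1)`, `m ∈ (m₀, m₁) ⊆ (0,1)`. [folklore] -/
private theorem bracket_bound_two {m₀ m₁ y m : ℝ} (hm₀ : 0 < m₀) (hm₁ : m₁ < 1)
    (hy : y ∈ Ioo (0:ℝ) 1) (hm : m ∈ Ioo m₀ m₁) :
    |(1 - 2 * y ^ 2) + (1 - m) * y ^ 2 * (1 - y ^ 2) / (1 - (1 - m) * y ^ 2)| ≤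
      1 + 1 / (1 - m₁) + 1 / m₀ := by
  obtain ⟨hy0, hy1⟩ := hy
  obtain ⟨hmm0, hmm1⟩ := hm
  have hm1 : 0 ≤ 1 - m := by linarith
  have hy2 : y ^ 2 ≤ 1 := by nlinarith
  have hD : m₀ ≤ 1 - (1 - m) * y ^ 2 := by nlinarith
  have hDpos : 0 < 1 - (1 - m) * y ^ 2 := hm₀.trans_le hD
  have hnum0 : 0 ≤ (1 - m) * y ^ 2 * (1 - y ^ 2) := by
    have : 0 ≤ 1 - y ^ 2 := by linarith
    positivity
  have hnum1 : (1 - m) * y ^ 2 * (1 - y ^ 2) ≤ 1 := by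
    have h' : (1 - m) * y ^ 2 ≤ 1 := by nlinarith
    have h'' : 0 ≤ (1 - m) * y ^ 2 := by positivity
    nlinarith
  have hq0 : 0 ≤ (1 - m) * y ^ 2 * (1 - y ^ 2) / (1 - (1 - m) * y ^ 2) :=
    div_nonneg hnum0 hDpos.le
  have hq1 : (1 - m) * y ^ 2 * (1 - y ^ 2) / (1 - (1 - m) * y ^ 2) ≤ 1 / m₀ :=
    div_le_div₀ zero_le_one hnum1 hm₀ hD
  have hm1' : 0 < 1 / (1 - m₁) := by
    have : 0 < 1 - m₁ := by linarith
    positivity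
  rw [abs_le]
  constructor <;> nlinarith [sq_nonneg y]

/-- The one-variable majorant factor `(1-u)^{-1/2}` is integrable on `(0,1)` (the Beta integrand
`B(1, ½)`). [folklore] -/
private theorem integrableOn_one_sub_rpow_neg_half :
    IntegrableOn (fun u : ℝ => (1 - u) ^ (-(1/2:ℝ))) (Ioo (0:ℝ) 1) := by
  open Literature.Analysis.SpecialFunctions.Selberg in
  have h := (integrableOn_Ioo_rpow_mul_one_sub_rpow_and_integral_eq
    (a := 1) (b := 1 / 2) one_pos (by norm_num)).1
  refine h.congr_fun (fun u _ => ?_) measurableSet_Ioo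
  show u ^ ((1:ℝ) - 1) * (1 - u) ^ ((1/2:ℝ) - 1) = (1 - u) ^ (-(1/2:ℝ))
  rw [sub_self, Real.rpow_zero, one_mul]
  norm_num

/-- **Absolute integrability of the Legendre divergence pieces** `g₁ = ∂ₓG₁`, `g₂ = ∂_yG₂` on the
open band `(0,1)² × (m₀,m₁)`, `0 < m₀ < m₁ < 1`: on the band
`|gᵢ| ≤ K(m₀,m₁) · (1−x)^{−1/2} (1−y)^{−1/2}`, a product of one-variable integrable functions
(arcsine / Beta integrand `B(1, ½)`), integrable for the product measure (Tonelli); the `gᵢ` are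
continuous on the open band. [cite: KontsevichZagier2001, §4.1] -/
theorem stub_legendreIntegrable :
    ∀ (m₀ m₁ : ℝ), 0 < m₀ → m₀ < m₁ → m₁ < 1 → IntegrableOn (fun z : Fin 3 → ℝ => (1 / 2 * z 1 ^ 2 * (1 / (Real.sqrt (1 - z 0 ^ 2) * Real.sqrt (1 - z 2 * z 0 ^ 2))) * (1 / (Real.sqrt (1 - z 1 ^ 2) * Real.sqrt (1 - (1 - z 2) * z 1 ^ 2))) * ((1 - 2 * z 0 ^ 2) + z 2 * z 0 ^ 2 * (1 - z 0 ^ 2) / (1 - z 2 * z 0 ^ 2)))) {z : Fin 3 → ℝ | (∀ j : Fin 2, z (Fin.castSucc j) ∈ Set.Ioo (0:ℝ) 1) ∧ z (Fin.last 2) ∈ Set.Ioo m₀ m₁} ∧ IntegrableOn (fun z : Fin 3 → ℝ => (-(1 / 2 * z 0 ^ 2 * (1 / (Real.sqrt (1 - z 0 ^ 2) * Real.sqrt (1 - z 2 * z 0 ^ 2))) * (1 / (Real.sqrt (1 - z 1 ^ 2) * Real.sqrt (1 - (1 - z 2) * z 1 ^ 2))) * ((1 - 2 * z 1 ^ 2)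 + (1 - z 2) * z 1 ^ 2 * (1 - z 1 ^ 2) / (1 - (1 - z 2) * z 1 ^ 2))))) {z : Fin 3 → ℝ | (∀ j : Fin 2, z (Fin.castSucc j) ∈ Set.Ioo (0:ℝ) 1) ∧ z (Fin.last 2) ∈ Set.Ioo m₀ m₁} := by
  intro m₀ m₁ hm₀ hm₀₁ hm₁
  set B : Set (Fin 3 → ℝ) := {z : Fin 3 → ℝ | (∀ j : Fin 2, z (Fin.castSucc j) ∈ Set.Ioo (0:ℝ) 1) ∧
    z (Fin.last 2) ∈ Set.Ioo m₀ m₁} with hBdef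
  -- membership in the band, coordinatewise
  have hmem : ∀ z ∈ B, (z 0 ∈ Ioo (0:ℝ) 1 ∧ z 1 ∈ Ioo (0:ℝ) 1) ∧ z 2 ∈ Ioo m₀ m₁ := by
    intro z hz
    rw [hBdef] at hz
    exact ⟨⟨hz.1 0, hz.1 1⟩, hz.2⟩
  -- the band is a box
  have hBpi : B = Set.pi univ (![Ioo 0 1, Ioo 0 1, Ioo m₀ m₁] : Fin 3 → Set ℝ) := by
    ext z
    rw [hBdef, mem_setOf_eq, mem_univ_pi, Fin.forall_fin_two]
    constructor
    · rintro ⟨⟨h0, h1⟩, h2⟩ i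
      fin_cases i
      · exact h0
      · exact h1
      · exact h2
    · intro h
      exact ⟨⟨h 0, h 1⟩, h 2⟩
  have hBopen : IsOpen B := by
    rw [hBpi]
    exact isOpen_set_pi finite_univ fun i _ => by fin_cases i <;> exact isOpen_Ioo
  have hBmeas : MeasurableSet B := hBopen.measurableSet
  -- Lebesgue measure restricted to the band is a product of restricted Lebesgue measures
  have hμ : (volume : Measure (Fin 3 → ℝ)).restrict B = Measure.pi (fun i =>
      (volume : Measure ℝ).restrict ((![Ioo 0 1, Ioo 0 1, Ioo m₀ m₁] : Fin 3 → Set ℝ) i)) := by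
    rw [hBpi, volume_pi, Measure.restrict_pi_pi]
  -- the majorant `K · (1-x)^{-1/2} (1-y)^{-1/2} · 1` is integrable on the band
  have hG : Integrable (fun z : Fin 3 → ℝ =>
      1 / 2 * (1 / Real.sqrt (1 - m₁)) * (1 / Real.sqrt m₀) * (1 + 1 / (1 - m₁) + 1 / m₀) *
        ∏ i : Fin 3, (![fun u : ℝ => (1 - u) ^ (-(1/2:ℝ)), fun u : ℝ => (1 - u) ^ (-(1/2:ℝ)),
          fun _ : ℝ => (1:ℝ)] : Fin 3 → ℝ → ℝ) i (z i))
      ((volume : Measure (Fin 3 → ℝ)).restrict B) := by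
    rw [hμ]
    refine Integrable.const_mul (Integrable.fintype_prod fun i => ?_) _
    fin_cases i
    · exact integrableOn_one_sub_rpow_neg_half
    · exact integrableOn_one_sub_rpow_neg_half
    · show IntegrableOn (fun _ : ℝ => (1:ℝ)) (Ioo m₀ m₁) volume
      exact integrableOn_const (by rw [Real.volume_Ioo]; exact ENNReal.ofReal_ne_top)
  have hprod : ∀ z : Fin 3 → ℝ,
      ∏ i : Fin 3, (![fun u : ℝ => (1 - u) ^ (-(1/2:ℝ)), fun u : ℝ => (1 - u) ^ (-(1/2:ℝ)),
          fun _ : ℝ => (1:ℝ)] : Fin 3 → ℝ → ℝ) i (z i) =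
        (1 - z 0) ^ (-(1/2:ℝ)) * (1 - z 1) ^ (-(1/2:ℝ)) := by
    intro z
    rw [Fin.prod_univ_three]
    simp
  -- positivity of the four square-root arguments on the band
  have hpos : ∀ z ∈ B, 0 < 1 - z 0 ^ 2 ∧ 0 < 1 - z 2 * z 0 ^ 2 ∧ 0 < 1 - z 1 ^ 2 ∧
      0 < 1 - (1 - z 2) * z 1 ^ 2 := by
    intro z hz
    obtain ⟨⟨⟨hx0, hx1⟩, ⟨hy0, hy1⟩⟩, ⟨hmm0, hmm1⟩⟩ := hmem z hz
    refine ⟨by nlinarith, by nlinarith, by nlinarith, by nlinarith⟩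
  constructor
  · refine Integrable.mono' hG ?_ ?_
    · refine (continuousOn_of_forall_continuousAt fun z hz => ?_).aestronglyMeasurable hBmeas
      obtain ⟨hA, hB', hC, hD⟩ := hpos z hz
      have hAB : Real.sqrt (1 - z 0 ^ 2) * Real.sqrt (1 - z 2 * z 0 ^ 2) ≠ 0 := by positivity
      have hCD : Real.sqrt (1 - z 1 ^ 2) * Real.sqrt (1 - (1 - z 2) * z 1 ^ 2) ≠ 0 := by positivity
      have cP : Continuous (fun z : Fin 3 → ℝ =>
          Real.sqrt (1 - z 0 ^ 2) * Real.sqrt (1 - z 2 * z 0 ^ 2)) := by fun_prop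
      have cQ : Continuous (fun z : Fin 3 → ℝ =>
          Real.sqrt (1 - z 1 ^ 2) * Real.sqrt (1 - (1 - z 2) * z 1 ^ 2)) := by fun_prop
      have cw : Continuous (fun z : Fin 3 → ℝ => 1 / 2 * z 1 ^ 2) := by fun_prop
      have cL : Continuous (fun z : Fin 3 → ℝ => 1 - 2 * z 0 ^ 2) := by fun_prop
      have cN : Continuous (fun z : Fin 3 → ℝ => z 2 * z 0 ^ 2 * (1 - z 0 ^ 2)) := by fun_prop
      have cD : Continuous (fun z : Fin 3 → ℝ => 1 - z 2 * z 0 ^ 2) := by fun_prop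
      exact ((cw.continuousAt.mul (continuousAt_const.div cP.continuousAt hAB)).mul
        (continuousAt_const.div cQ.continuousAt hCD)).mul
        (cL.continuousAt.add (cN.continuousAt.div cD.continuousAt hB'.ne'))
    · refine ae_restrict_of_forall_mem hBmeas fun z hz => ?_
      obtain ⟨⟨hx, hy⟩, hm⟩ := hmem z hz
      rw [Real.norm_eq_abs, hprod z]
      exact core_bound hm₀ hm₁ hx hy hm (sq_nonneg _) (by nlinarith [hy.1, hy.2])
        (bracket_bound_one hm₀ hm₁ hx hm)
  · refine Integrable.mono' hG ?_ ?_
    · refine (continuousOn_of_forall_continuousAt fun z hz => ?_).aestronglyMeasurable hBmeas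
      obtain ⟨hA, hB', hC, hD⟩ := hpos z hz
      have hAB : Real.sqrt (1 - z 0 ^ 2) * Real.sqrt (1 - z 2 * z 0 ^ 2) ≠ 0 := by positivity
      have hCD : Real.sqrt (1 - z 1 ^ 2) * Real.sqrt (1 - (1 - z 2) * z 1 ^ 2) ≠ 0 := by positivity
      have cP : Continuous (fun z : Fin 3 → ℝ =>
          Real.sqrt (1 - z 0 ^ 2) * Real.sqrt (1 - z 2 * z 0 ^ 2)) := by fun_prop
      have cQ : Continuous (fun z : Fin 3 → ℝ =>
          Real.sqrt (1 - z 1 ^ 2) * Real.sqrt (1 - (1 - z 2) * z 1 ^ 2)) := by fun_prop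
      have cw : Continuous (fun z : Fin 3 → ℝ => 1 / 2 * z 0 ^ 2) := by fun_prop
      have cL : Continuous (fun z : Fin 3 → ℝ => 1 - 2 * z 1 ^ 2) := by fun_prop
      have cN : Continuous (fun z : Fin 3 → ℝ => (1 - z 2) * z 1 ^ 2 * (1 - z 1 ^ 2)) := by
        fun_prop
      have cD : Continuous (fun z : Fin 3 → ℝ => 1 - (1 - z 2) * z 1 ^ 2) := by fun_prop
      exact (((cw.continuousAt.mul (continuousAt_const.div cP.continuousAt hAB)).mul
        (continuousAt_const.div cQ.continuousAt hCD)).mul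
        (cL.continuousAt.add (cN.continuousAt.div cD.continuousAt hD.ne'))).neg
    · refine ae_restrict_of_forall_mem hBmeas fun z hz => ?_
      obtain ⟨⟨hx, hy⟩, hm⟩ := hmem z hz
      rw [Real.norm_eq_abs, hprod z, abs_neg]
      exact core_bound hm₀ hm₁ hx hy hm (sq_nonneg _) (by nlinarith [hx.1, hx.2])
        (bracket_bound_two hm₀ hm₁ hy hm)

end Summit.KontsevichZagierPeriods.KontsevichZagierPeriods.CompleteModGammaSectorEngine
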